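import Summits.KontsevichZagierPeriods.KontsevichZagierPeriods.Theses.WZCosetWall

/-!
# `Assembly` (stmt-KontsevichZagierPeriods-6880, route WZCosetWall) — proof

The route's assembly item
`SummationClosure → SeriesKernel → KontsevichZagierPeriods`
is its deciding theorem `closes` read as an implication. (lead c10 of crux 9129, banking)
-/

namespace Summit.KontsevichZagierPeriods.WZCosetWall

/-- **Assembly of route WZCosetWall** (stmt-KontsevichZagierPeriods-6880):
`SummationClosure → SeriesKernel → KontsevichZagierPeriods`
— the cruxes imply the summit, by the route's deciding theorem `closes`.
[Kontsevich–Zagier 2001, §1.2] [folklore] -/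
theorem assembly_proof :
    Summit.KontsevichZagierPeriods.KontsevichZagierPeriods.Theses.WZCosetWall.Assembly :=
  Summit.KontsevichZagierPeriods.KontsevichZagierPeriods.Theses.WZCosetWall.closes

end Summit.KontsevichZagierPeriods.WZCosetWall
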